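import Mathlib

/-!
# Tier7/Line3/SummableOfCountDecay — absolute convergence from a polynomial count and a polynomial decay
(seat t7-x1)

LINE 3 (t7-plan-3), version-(ii) isolation: the geometric side of the two-torus relative trace formula with `L¹`
test functions at the `U(1,1)`-places is an INFINITE sum over double cosets, and the dominant-term rows (p1
`T7SupportDominantTermPolynomialNonzero.exists_tsum_ne_zero_of_polynomial`, `DominantSide.abs_summable`) take its
ABSOLUTE CONVERGENCE as a hypothesis. THIS FILE discharges it from the two hypotheses those rows already carry: a
polynomial DECAY `‖w x‖ ≤ C (1 + size x)^{−α}` on the orbits carrying weight and a polynomial COUNT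
`#{x carrying weight : size x ≤ R} ≤ C′ (1 + R)^β`, with `β < α`. Dyadic shells `2^k ≤ 1 + size x < 2^{k+1}`:
every finite partial sum is at most `C C′ 2^β ∑_k 2^{(β−α) k}`, a convergent geometric series, so the family is
summable (`summable_of_sum_le`).

Mathlib only; nothing here is about a group, a double coset, an orbital integral or a period. Blind lane; no
sorry; axioms ⊆ {propext, Classical.choice, Quot.sound}.
-/

namespace Summit.Ventures.HodgeRepro2.Tier7.Line3.SummableOfCountDecay

open Finset

variable {Orb : Type*}

/-- the dyadic bracket of a size: `⌊log₂ (1 + size x)⌋₊`. -/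
noncomputable def bracket (size : Orb → ℝ) (x : Orb) : ℕ := ⌊Real.logb 2 (1 + size x)⌋₊

/-- `2 ^ bracket ≤ 1 + size`. -/
theorem two_rpow_bracket_le (size : Orb → ℝ) (x : Orb) (hx : 0 ≤ size x) :
    (2 : ℝ) ^ (bracket size x : ℝ) ≤ 1 + size x := by
  have h1 : 1 ≤ 1 + size x := by linarith
  have hlog : 0 ≤ Real.logb 2 (1 + size x) := Real.logb_nonneg one_lt_two h1
  calc (2 : ℝ) ^ (bracket size x : ℝ) ≤ 2 ^ Real.logb 2 (1 + size x) :=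
        Real.rpow_le_rpow_of_exponent_le one_le_two (Nat.floor_le hlog)
    _ = 1 + size x := Real.rpow_logb two_pos (by norm_num) (by linarith)

/-- `1 + size < 2 ^ (bracket + 1)`. -/
theorem lt_two_rpow_bracket_succ (size : Orb → ℝ) (x : Orb) (hx : 0 ≤ size x) :
    1 + size x < (2 : ℝ) ^ ((bracket size x : ℝ) + 1) := by
  have h : Real.logb 2 (1 + size x) < (bracket size x : ℝ) + 1 := Nat.lt_floor_add_one _
  calc 1 + size x = 2 ^ Real.logb 2 (1 + size x) :=
        (Real.rpow_logb two_pos (by norm_num) (by linarith)).symm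
    _ < (2 : ℝ) ^ ((bracket size x : ℝ) + 1) := Real.rpow_lt_rpow_of_exponent_lt one_lt_two h

/-- **absolute convergence from count and decay**: `‖w x‖ ≤ C (1 + size x)^{−α}` on the orbits carrying weight
(`arith`), `#{arith, size ≤ R} ≤ C′ (1 + R)^β`, `0 ≤ β < α` ⇒ `∑ ‖w x‖ < ∞`. -/
theorem summable_norm_of_count_decay (size : Orb → ℝ) (hsize : ∀ x, 0 ≤ size x) (w : Orb → ℂ)
    (arith : Orb → Prop) (hsupp : ∀ x, w x ≠ 0 → arith x) {α β C C' : ℝ} (hβ : 0 ≤ β) (hαβ : β < α)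
    (hbound : ∀ x, arith x → ‖w x‖ ≤ C * (1 + size x) ^ (-α))
    (hcount : ∀ R : ℝ, 0 ≤ R →
      ∃ s : Finset Orb, (∀ x, arith x → size x ≤ R → x ∈ s) ∧ (s.card : ℝ) ≤ C' * (1 + R) ^ β) :
    Summable fun x => ‖w x‖ := by
  classical
  have hα : 0 < α := hβ.trans_lt hαβ
  set Cp : ℝ := max C 0 with hCp
  set Cq : ℝ := max C' 0 with hCq
  have hCp0 : 0 ≤ Cp := le_max_right _ _
  have hCq0 : 0 ≤ Cq := le_max_right _ _
  -- the geometric ratio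
  set r : ℝ := (2 : ℝ) ^ (β - α) with hr
  have hr0 : 0 ≤ r := by positivity
  have hr1 : r < 1 := Real.rpow_lt_one_of_one_lt_of_neg one_lt_two (by linarith)
  set g : ℕ → ℝ := fun k => Cp * Cq * (2 : ℝ) ^ β * r ^ k with hg
  have hg0 : ∀ k, 0 ≤ g k := fun k => by positivity
  have hgs : Summable g := (summable_geometric_of_lt_one hr0 hr1).mul_left _
  -- the bound on one dyadic shell of a finset
  have hshell : ∀ (u : Finset Orb) (k : ℕ),
      ∑ x ∈ (u.filter arith).filter (fun x => bracket size x = k), ‖w x‖ ≤ g k := by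
    intro u k
    set S := (u.filter arith).filter (fun x => bracket size x = k) with hS
    have hmemS : ∀ x ∈ S, arith x ∧ bracket size x = k := by
      intro x hx
      simp only [hS, Finset.mem_filter] at hx
      exact ⟨hx.1.2, hx.2⟩
    -- pointwise decay on the shell
    have hpt : ∀ x ∈ S, ‖w x‖ ≤ Cp * (2 : ℝ) ^ ((k : ℝ) * (-α)) := by
      intro x hx
      obtain ⟨ha, hk⟩ := hmemS x hx
      have h2k : (2 : ℝ) ^ (k : ℝ) ≤ 1 + size x := by
        have := two_rpow_bracket_le size x (hsize x)
        rwa [hk] at this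
      have hpos : (0 : ℝ) < (2 : ℝ) ^ (k : ℝ) := by positivity
      calc ‖w x‖ ≤ C * (1 + size x) ^ (-α) := hbound x ha
        _ ≤ Cp * (1 + size x) ^ (-α) :=
            mul_le_mul_of_nonneg_right (le_max_left _ _) (Real.rpow_nonneg (by linarith [hsize x]) _)
        _ ≤ Cp * ((2 : ℝ) ^ (k : ℝ)) ^ (-α) :=
            mul_le_mul_of_nonneg_left (Real.rpow_le_rpow_of_nonpos hpos h2k (by linarith)) hCp0
        _ = Cp * (2 : ℝ) ^ ((k : ℝ) * (-α)) := by rw [← Real.rpow_mul (by norm_num)]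
    -- the shell is inside the count finset at radius `2 ^ (k + 1) - 1`
    have hR : (0 : ℝ) ≤ (2 : ℝ) ^ ((k : ℝ) + 1) - 1 := by
      have : (1 : ℝ) ≤ (2 : ℝ) ^ ((k : ℝ) + 1) := Real.one_le_rpow one_le_two (by positivity)
      linarith
    obtain ⟨t, htmem, htcard⟩ := hcount _ hR
    have hsub : S ⊆ t := by
      intro x hx
      obtain ⟨ha, hk⟩ := hmemS x hx
      refine htmem x ha ?_
      have := lt_two_rpow_bracket_succ size x (hsize x)
      rw [hk] at this
      linarith
    have hcard : (S.card : ℝ) ≤ Cq * (2 : ℝ) ^ β * (2 : ℝ) ^ ((k : ℝ) * β) := by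
      calc (S.card : ℝ) ≤ (t.card : ℝ) := by exact_mod_cast Finset.card_le_card hsub
        _ ≤ C' * (1 + ((2 : ℝ) ^ ((k : ℝ) + 1) - 1)) ^ β := htcard
        _ = C' * ((2 : ℝ) ^ β * (2 : ℝ) ^ ((k : ℝ) * β)) := by
            have h2 : (1 + ((2 : ℝ) ^ ((k : ℝ) + 1) - 1)) = 2 * (2 : ℝ) ^ (k : ℝ) := by
              rw [Real.rpow_add two_pos, Real.rpow_one]; ring
            rw [h2, Real.mul_rpow (by norm_num) (by positivity), ← Real.rpow_mul (by norm_num)]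
        _ ≤ Cq * ((2 : ℝ) ^ β * (2 : ℝ) ^ ((k : ℝ) * β)) :=
            mul_le_mul_of_nonneg_right (le_max_left _ _) (by positivity)
        _ = Cq * (2 : ℝ) ^ β * (2 : ℝ) ^ ((k : ℝ) * β) := by ring
    have hprod : (2 : ℝ) ^ ((k : ℝ) * β) * (2 : ℝ) ^ ((k : ℝ) * (-α)) = r ^ k := by
      rw [hr, ← Real.rpow_natCast ((2 : ℝ) ^ (β - α)) k, ← Real.rpow_mul (by norm_num),
        ← Real.rpow_add two_pos]
      congr 1
      ring
    calc ∑ x ∈ S, ‖w x‖ ≤ ∑ x ∈ S, Cp * (2 : ℝ) ^ ((k : ℝ) * (-α)) := Finset.sum_le_sum hpt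
      _ = (S.card : ℝ) * (Cp * (2 : ℝ) ^ ((k : ℝ) * (-α))) := by
          rw [Finset.sum_const, nsmul_eq_mul]
      _ ≤ (Cq * (2 : ℝ) ^ β * (2 : ℝ) ^ ((k : ℝ) * β)) * (Cp * (2 : ℝ) ^ ((k : ℝ) * (-α))) :=
          mul_le_mul_of_nonneg_right hcard (by positivity)
      _ = Cp * Cq * (2 : ℝ) ^ β * ((2 : ℝ) ^ ((k : ℝ) * β) * (2 : ℝ) ^ ((k : ℝ) * (-α))) := by ring
      _ = g k := by rw [hprod]
  -- every finite partial sum is bounded by `∑' g`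
  refine summable_of_sum_le (fun x => norm_nonneg _) (c := ∑' k, g k) ?_
  intro u
  have h0 : ∑ x ∈ u, ‖w x‖ = ∑ x ∈ u.filter arith, ‖w x‖ := by
    rw [Finset.sum_filter]
    refine Finset.sum_congr rfl fun x _ => ?_
    by_cases h : arith x
    · simp [h]
    · have hw : w x = 0 := by
        by_contra hw
        exact h (hsupp x hw)
      simp [h, hw]
  rw [h0]
  have hfib : ∑ x ∈ u.filter arith, ‖w x‖ =
      ∑ k ∈ (u.filter arith).image (bracket size),
        ∑ x ∈ (u.filter arith).filter (fun x => bracket size x = k), ‖w x‖ :=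
    (Finset.sum_fiberwise_of_maps_to (fun x hx => Finset.mem_image_of_mem _ hx) _).symm
  rw [hfib]
  calc ∑ k ∈ (u.filter arith).image (bracket size),
        ∑ x ∈ (u.filter arith).filter (fun x => bracket size x = k), ‖w x‖
      ≤ ∑ k ∈ (u.filter arith).image (bracket size), g k := Finset.sum_le_sum fun k _ => hshell u k
    _ ≤ ∑' k, g k := hgs.sum_le_tsum _ (fun k _ => hg0 k)

/-- **the `abs_summable` field of the dominant-term rows, discharged from their other fields**: with
`w N x = a x · b N x`, `‖a x‖ ≤ C (1 + size x)^{−α}`, `‖b N x‖ ≤ B (1 + size x)^{d′} ‖b N x₀‖` on the orbits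
carrying weight, the polynomial count with exponent `β`, and the exponent condition `β + d′ < α` (the hypotheses
of `T7SupportDominantTermPolynomial.tail_le_half_of_polynomial` verbatim), `∑ ‖w N x‖ < ∞` for every `N`. -/
theorem summable_norm_mul_of_polynomial (x0 : Orb) (size : Orb → ℝ) (size_nonneg : ∀ x, 0 ≤ size x)
    (arith : ℕ → Orb → Prop) (a : Orb → ℂ) (b : ℕ → Orb → ℂ) (w : ℕ → Orb → ℂ)
    (hw : ∀ N x, w N x = a x * b N x) (b_support : ∀ N x, b N x ≠ 0 → arith N x)
    (α β d' : ℝ) (hβ : 0 ≤ β) (_hd' : 0 ≤ d') (hαβ : β + d' < α)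
    (a_bound : ∃ C : ℝ, ∀ x, ‖a x‖ ≤ C * (1 + size x) ^ (-α))
    (count_bound : ∃ C' : ℝ, ∀ N (R : ℝ), 0 ≤ R →
      ∃ s : Finset Orb, (∀ x, arith N x → size x ≤ R → x ∈ s) ∧ (s.card : ℝ) ≤ C' * (1 + R) ^ β)
    (b_bound : ∃ B : ℝ, ∀ N x, arith N x → ‖b N x‖ ≤ B * (1 + size x) ^ d' * ‖b N x0‖) :
    ∀ N, Summable fun x => ‖w N x‖ := by
  obtain ⟨C, hC⟩ := a_bound
  obtain ⟨C', hC'⟩ := count_bound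
  obtain ⟨B, hB⟩ := b_bound
  intro N
  refine summable_norm_of_count_decay size size_nonneg (w N) (arith N) ?_ (α := α - d') (β := β)
    (C := C * B * ‖b N x0‖) (C' := C') hβ (by linarith) ?_ (hC' N)
  · intro x hx
    refine b_support N x fun hb => hx ?_
    rw [hw, hb, mul_zero]
  · intro x hx
    have h1 : ‖a x‖ ≤ C * (1 + size x) ^ (-α) := hC x
    have h2 : ‖b N x‖ ≤ B * (1 + size x) ^ d' * ‖b N x0‖ := hB N x hx
    have hs : (0 : ℝ) < 1 + size x := by linarith [size_nonneg x]
    calc ‖w N x‖ = ‖a x‖ * ‖b N x‖ := by rw [hw, norm_mul]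
      _ ≤ (C * (1 + size x) ^ (-α)) * (B * (1 + size x) ^ d' * ‖b N x0‖) :=
          mul_le_mul h1 h2 (norm_nonneg _) ((norm_nonneg _).trans h1)
      _ = C * B * ‖b N x0‖ * ((1 + size x) ^ (-α) * (1 + size x) ^ d') := by ring
      _ = C * B * ‖b N x0‖ * (1 + size x) ^ (-(α - d')) := by
          rw [← Real.rpow_add hs]
          congr 1
          ring_nf

end Summit.Ventures.HodgeRepro2.Tier7.Line3.SummableOfCountDecay
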